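import Summits.QuantumFields.YangMills.Theorems.ColdStartUniversalityLatticeLangevinFeller
import Summits.QuantumFields.YangMills.Theorems.ColdStartUniversalityLatticeLangevinStochasticContinuity
import Summits.QuantumFields.YangMills.Theorems.ColdStartUniversalityLatticeLangevinCocycleMain
import HarnessLib

/-!
# Route `ColdStartUniversality` (fixed-cut-off package): the SU(2) lattice Langevin transition kernels act JOINTLY
# CONTINUOUSLY in (time, start) on continuous observables — a C₀-Feller semigroup

Helper file (seat `ym-line-csu-p1`, g15).  For every Markov kernel family `κ` realising the transition laws of the
Shen–Zhu–Zhu dynamics on `SU(2)^E` (`E = Edge 3 L`) at coupling `β'` and every continuous `f`: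

* `abs_integral_transitionKernel_sub_self_le` — UNIFORM-IN-START SMALL-TIME CONTINUITY: for `ε > 0` there is `C_ε` with
  `|∫ f d(κ h y) - f(y)| ≤ ε + C_ε (h² + h)` for all starts `y` and lattice times `h` (modulus of continuity of `f` for the
  Hilbert–Schmidt «distance» + the uniform stochastic continuity `measureReal_hsDist_start_ge_le`, seat g9);
* `abs_integral_transitionKernel_add_sub_le` — hence `|κ_{s+h} f (x) - κ_s f (x)| ≤ ε + C_ε (h² + h)` uniformly in `s, x`
  (Chapman–Kolmogorov `chapmanKolmogorov_szz`, seat g5/g6);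
* ★ `continuous_transitionKernel_action` — `(t, x) ↦ ∫ f d(κ t x) = E f(U^x_t)` is jointly continuous on `ℝ≥0 × SU(2)^E`
  (with the Feller property `continuous_integral_transitionKernel`, seat g6).

This is the hypothesis `hK`/`hT` of the abstract reversibility theorem `integral_mul_kernel_symm_of_duhamel`.  THEOREMS ONLY, no
definition, no sorry.  RECORD-rung R3 plumbing (fixed cut-off `K`); nothing here bears on the Yang–Mills mass gap.
-/

set_option autoImplicit false

noncomputable section

namespace Summit.QuantumFields.YangMills.Theorems.ColdStartUniversality

open MeasureTheory ProbabilityTheory Filter Topology Set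
open scoped NNReal ENNReal
open Literature.Probability.Process Literature.MathematicalPhysics.QuantumFieldTheory
open Literature.MathematicalPhysics.QuantumLattice (fundamentalRep fundamentalLatticeRep continuous_fundamentalRep)

variable {L : ℕ} [NeZero L]

/-- **Uniform-in-start small-time continuity of the SZZ transition kernels on a continuous observable**: for every
continuous `f` and `ε > 0` there is `C ≥ 0` with `|∫ f d(κ h y) - f y| ≤ ε + C · (h² + h)` for ALL starts `y` and lattice times
`h`. [cite: RevuzYor1999, Ch. IX Thm (1.7)] -/
theorem abs_integral_transitionKernel_sub_self_le (β' : ℝ)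
    (κ : ℝ≥0 → Kernel (GaugeConfig 3 L (Matrix.specialUnitaryGroup (Fin 2) ℂ))
      (GaugeConfig 3 L (Matrix.specialUnitaryGroup (Fin 2) ℂ))) [∀ t, IsMarkovKernel (κ t)]
    (hreal : ∀ (t : ℝ≥0) (x : GaugeConfig 3 L (Matrix.specialUnitaryGroup (Fin 2) ℂ))
        (Ω : Type) [MeasurableSpace Ω] (P : Measure Ω) [IsProbabilityMeasure P]
        (W : ℝ≥0 → Ω → (Edge 3 L × NoiseIdx 2 → ℝ)) (hW : IsFlatBrownian W P)
        (U : ℝ≥0 → Ω → GaugeConfig 3 L (Matrix.specialUnitaryGroup (Fin 2) ℂ)),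
        (∀ ω, U 0 ω = x) →
        (latticeLangevinDynamics (fundamentalLatticeRep 2) β').IsSolution (fundamentalRep (Fin 2))
          hW.natFiltration P W U →
        κ t x = P.map (U t))
    {f : GaugeConfig 3 L (Matrix.specialUnitaryGroup (Fin 2) ℂ) → ℝ} (hf : Continuous f) {ε : ℝ} (hε : 0 < ε) :
    ∃ C : ℝ, 0 ≤ C ∧ ∀ (h : ℝ≥0) (y : GaugeConfig 3 L (Matrix.specialUnitaryGroup (Fin 2) ℂ)),
      |(∫ z, f z ∂(κ h y)) - f y| ≤ ε + C * (((h : ℝ) ^ 2) + h) := by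
  classical
  haveI := secondCountableTopology_su2
  haveI := borelSpace_config L
  obtain ⟨M, hM0, hM⟩ := exists_abs_le_of_continuous hf
  obtain ⟨δ, hδ, hmod⟩ := exists_hsDist_modulus (L := L) hf hε
  obtain ⟨C, hC0, hC⟩ := measureReal_hsDist_start_ge_le L β'
  refine ⟨2 * M * (C / δ), by positivity, fun h y => ?_⟩
  -- a solution from `y` on the product Wiener space realises `κ h y`
  haveI := isProbabilityMeasure_piWiener (Edge 3 L × NoiseIdx 2)
  have hWc := isFlatBrownian_piWiener 3 L (NoiseIdx 2)
  obtain ⟨U, hU0, hU⟩ := solution_from_start hWc β' y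
  set P : Measure ((Edge 3 L × NoiseIdx 2) → ℝ≥0 → ℝ) :=
    Measure.pi fun _ : Edge 3 L × NoiseIdx 2 => preWienerMeasure with hP
  have hmU : Measurable (U h) := (hU.adapted h).mono (hWc.natFiltration.le h) le_rfl
  have hκ : κ h y = P.map (U h) := hreal h y _ P _ hWc U hU0 hU
  -- the distance-to-`y` observable and the bad event
  set D : GaugeConfig 3 L (Matrix.specialUnitaryGroup (Fin 2) ℂ) → ℝ := fun z => ∑ e, hsForm 2
      ((fundamentalRep (Fin 2) (z e) : Matrix (Fin 2) (Fin 2) ℂ) - fundamentalRep (Fin 2) (y e))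
      ((fundamentalRep (Fin 2) (z e) : Matrix (Fin 2) (Fin 2) ℂ) - fundamentalRep (Fin 2) (y e)) with hD
  have hDc : Continuous D := continuous_hsDist continuous_id continuous_const
  set A : Set ((Edge 3 L × NoiseIdx 2) → ℝ≥0 → ℝ) := {ω | δ ≤ D (U h ω)} with hA
  have hAm : MeasurableSet A := measurableSet_le measurable_const (hDc.measurable.comp hmU)
  have hPA : P.real A ≤ C * (((h : ℝ) ^ 2) + h) / δ := hC y _ P _ hWc U hU0 hU h δ hδ
  -- pointwise: `|f (U_h ω) - f y| ≤ ε + 2M · 1_A(ω)`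
  have hpt : ∀ ω, |f (U h ω) - f y| ≤ ε + 2 * M * A.indicator (fun _ => (1 : ℝ)) ω := by
    intro ω
    by_cases hω : ω ∈ A
    · rw [indicator_of_mem hω, mul_one]
      calc |f (U h ω) - f y| ≤ |f (U h ω)| + |f y| := abs_sub _ _
        _ ≤ M + M := add_le_add (hM _) (hM _)
        _ = 2 * M := by ring
        _ ≤ ε + 2 * M := by linarith
    · rw [indicator_of_notMem hω, mul_zero, add_zero]
      have hlt : D (U h ω) < δ := not_le.1 hω
      exact (hmod (U h ω) y hlt).le
  -- integrate
  have hfi : Integrable (fun ω => f (U h ω)) P :=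
    Integrable.of_bound (hf.measurable.comp hmU).aestronglyMeasurable M
      (Eventually.of_forall fun ω => by rw [Real.norm_eq_abs]; exact hM _)
  have hgi : Integrable (fun ω => f (U h ω) - f y) P := hfi.sub (integrable_const _)
  have hbi : Integrable (fun ω => ε + 2 * M * A.indicator (fun _ => (1 : ℝ)) ω) P :=
    (integrable_const ε).add (((integrable_const (1 : ℝ)).indicator hAm).const_mul (2 * M))
  have e1 : (∫ z, f z ∂(κ h y)) - f y = ∫ ω, (f (U h ω) - f y) ∂P := by
    rw [hκ, integral_map hmU.aemeasurable hf.aestronglyMeasurable, integral_sub hfi (integrable_const _), integral_const,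
      probReal_univ, one_smul]
  rw [e1]
  calc |∫ ω, (f (U h ω) - f y) ∂P| ≤ ∫ ω, |f (U h ω) - f y| ∂P := abs_integral_le_integral_abs
    _ ≤ ∫ ω, (ε + 2 * M * A.indicator (fun _ => (1 : ℝ)) ω) ∂P := integral_mono hgi.abs hbi hpt
    _ = ε + 2 * M * P.real A := by
        rw [integral_add (integrable_const ε) (((integrable_const (1 : ℝ)).indicator hAm).const_mul (2 * M)),
          integral_const, probReal_univ, one_smul, integral_const_mul, integral_indicator_const _ hAm, smul_eq_mul, mul_one]
    _ ≤ ε + 2 * M * (C * (((h : ℝ) ^ 2) + h) / δ) := by gcongr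
    _ = ε + 2 * M * (C / δ) * (((h : ℝ) ^ 2) + h) := by ring

/-- **Uniform-in-time-and-start continuity of the SZZ transition semigroup in time**: for continuous `f` and `ε > 0` there is
`C ≥ 0` with `|∫ f d(κ (s + h) x) - ∫ f d(κ s x)| ≤ ε + C (h² + h)` for ALL `s, h, x` (Chapman–Kolmogorov + the small-time
estimate). [cite: ShenZhuZhu2022, §3 (Markov semigroup P_t^L after Lemma 3.3, p. 13)] -/
theorem abs_integral_transitionKernel_add_sub_le (β' : ℝ)
    (κ : ℝ≥0 → Kernel (GaugeConfig 3 L (Matrix.specialUnitaryGroup (Fin 2) ℂ))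
      (GaugeConfig 3 L (Matrix.specialUnitaryGroup (Fin 2) ℂ))) [∀ t, IsMarkovKernel (κ t)]
    (hreal : ∀ (t : ℝ≥0) (x : GaugeConfig 3 L (Matrix.specialUnitaryGroup (Fin 2) ℂ))
        (Ω : Type) [MeasurableSpace Ω] (P : Measure Ω) [IsProbabilityMeasure P]
        (W : ℝ≥0 → Ω → (Edge 3 L × NoiseIdx 2 → ℝ)) (hW : IsFlatBrownian W P)
        (U : ℝ≥0 → Ω → GaugeConfig 3 L (Matrix.specialUnitaryGroup (Fin 2) ℂ)),
        (∀ ω, U 0 ω = x) →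
        (latticeLangevinDynamics (fundamentalLatticeRep 2) β').IsSolution (fundamentalRep (Fin 2))
          hW.natFiltration P W U →
        κ t x = P.map (U t))
    {f : GaugeConfig 3 L (Matrix.specialUnitaryGroup (Fin 2) ℂ) → ℝ} (hf : Continuous f) {ε : ℝ} (hε : 0 < ε) :
    ∃ C : ℝ, 0 ≤ C ∧ ∀ (s h : ℝ≥0) (x : GaugeConfig 3 L (Matrix.specialUnitaryGroup (Fin 2) ℂ)),
      |(∫ z, f z ∂(κ (s + h) x)) - ∫ z, f z ∂(κ s x)| ≤ ε + C * (((h : ℝ) ^ 2) + h) := by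
  classical
  haveI := secondCountableTopology_su2
  haveI := borelSpace_config L
  obtain ⟨C, hC0, hC⟩ := abs_integral_transitionKernel_sub_self_le (L := L) β' κ hreal hf hε
  refine ⟨C, hC0, fun s h x => ?_⟩
  obtain ⟨M, hM0, hM⟩ := exists_abs_le_of_continuous hf
  -- Chapman–Kolmogorov: `κ (s + h) = κ h ∘ₖ κ s`
  have hCK : κ (s + h) = κ h ∘ₖ κ s := chapmanKolmogorov_szz β' κ hreal s h
  have hfi : ∀ (ν : Measure (GaugeConfig 3 L (Matrix.specialUnitaryGroup (Fin 2) ℂ))) [IsProbabilityMeasure ν],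
      Integrable f ν := fun ν _ =>
    Integrable.of_bound hf.aestronglyMeasurable M (Eventually.of_forall fun z => by rw [Real.norm_eq_abs]; exact hM z)
  haveI : IsProbabilityMeasure ((κ h ∘ₖ κ s) x) := by rw [← hCK]; infer_instance
  have e1 : ∫ z, f z ∂(κ (s + h) x) = ∫ y, (∫ z, f z ∂(κ h y)) ∂(κ s x) := by
    rw [hCK]
    exact Kernel.integral_comp (hfi _)
  -- the inner function is continuous (Feller) hence integrable
  have hgc : Continuous fun y => ∫ z, f z ∂(κ h y) := continuous_integral_transitionKernel L β' κ hreal h hf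
  have hgi : Integrable (fun y => ∫ z, f z ∂(κ h y)) (κ s x) := by
    refine Integrable.of_bound hgc.aestronglyMeasurable M (Eventually.of_forall fun y => ?_)
    have hb := norm_integral_le_of_norm_le_const (μ := κ h y) (f := f) (C := M)
      (Eventually.of_forall fun z => by rw [Real.norm_eq_abs]; exact hM z)
    rwa [probReal_univ, mul_one] at hb
  rw [e1, ← integral_sub hgi (hfi _)]
  have hb := norm_integral_le_of_norm_le_const (μ := κ s x) (f := fun y => (∫ z, f z ∂(κ h y)) - f y)
    (C := ε + C * (((h : ℝ) ^ 2) + h)) (Eventually.of_forall fun y => by rw [Real.norm_eq_abs]; exact hC h y)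
  rwa [Real.norm_eq_abs, probReal_univ, mul_one] at hb

/-- ★ **The SZZ transition semigroup is jointly continuous in (time, start) on continuous observables**: for every Markov
kernel family realising the transition laws of the SU(2) lattice Langevin dynamics at coupling `β'` and every continuous `f`,
the map `(t, x) ↦ ∫ f d(κ t x) = E f(U^x_t)` is continuous on `ℝ≥0 × SU(2)^E` (Feller in `x`, `continuous_integral_transitionKernel`;
uniformly continuous in `t`, `abs_integral_transitionKernel_add_sub_le`).
[cite: ShenZhuZhu2022, §3 (Markov semigroup P_t^L after Lemma 3.3, p. 13)] -/
theorem continuous_transitionKernel_action (β' : ℝ)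
    (κ : ℝ≥0 → Kernel (GaugeConfig 3 L (Matrix.specialUnitaryGroup (Fin 2) ℂ))
      (GaugeConfig 3 L (Matrix.specialUnitaryGroup (Fin 2) ℂ))) [∀ t, IsMarkovKernel (κ t)]
    (hreal : ∀ (t : ℝ≥0) (x : GaugeConfig 3 L (Matrix.specialUnitaryGroup (Fin 2) ℂ))
        (Ω : Type) [MeasurableSpace Ω] (P : Measure Ω) [IsProbabilityMeasure P]
        (W : ℝ≥0 → Ω → (Edge 3 L × NoiseIdx 2 → ℝ)) (hW : IsFlatBrownian W P)
        (U : ℝ≥0 → Ω → GaugeConfig 3 L (Matrix.specialUnitaryGroup (Fin 2) ℂ)),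
        (∀ ω, U 0 ω = x) →
        (latticeLangevinDynamics (fundamentalLatticeRep 2) β').IsSolution (fundamentalRep (Fin 2))
          hW.natFiltration P W U →
        κ t x = P.map (U t))
    {f : GaugeConfig 3 L (Matrix.specialUnitaryGroup (Fin 2) ℂ) → ℝ} (hf : Continuous f) :
    Continuous fun p : ℝ≥0 × GaugeConfig 3 L (Matrix.specialUnitaryGroup (Fin 2) ℂ) => ∫ z, f z ∂(κ p.1 p.2) := by
  classical
  refine continuous_iff_continuousAt.2 fun p₀ => ?_
  obtain ⟨t₀, x₀⟩ := p₀
  refine Metric.tendsto_nhds.2 fun ε hε => ?_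
  -- time direction: uniform modulus
  obtain ⟨C, hC0, hC⟩ := abs_integral_transitionKernel_add_sub_le (L := L) β' κ hreal hf (show (0 : ℝ) < ε / 4 by positivity)
  -- choose `η ∈ (0, 1]` with `C (η² + η) ≤ ε / 4`
  obtain ⟨η, hη0, hη1, hηC⟩ : ∃ η : ℝ, 0 < η ∧ η ≤ 1 ∧ C * (η ^ 2 + η) ≤ ε / 4 := by
    refine ⟨min 1 (ε / (8 * (C + 1))), lt_min one_pos (by positivity), min_le_left _ _, ?_⟩
    set η : ℝ := min 1 (ε / (8 * (C + 1))) with hηdef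
    have hη0 : 0 < η := lt_min one_pos (by positivity)
    have hη1 : η ≤ 1 := min_le_left _ _
    have hη2 : η ≤ ε / (8 * (C + 1)) := min_le_right _ _
    have hsq : η ^ 2 ≤ η := by nlinarith
    calc C * (η ^ 2 + η) ≤ C * (η + η) := by gcongr
      _ = 2 * C * η := by ring
      _ ≤ 2 * (C + 1) * (ε / (8 * (C + 1))) := by gcongr; linarith
      _ = ε / 4 := by field_simp; ring
  have htime : ∀ (s s' : ℝ≥0), dist s s' < η → ∀ x,
      |(∫ z, f z ∂(κ s x)) - ∫ z, f z ∂(κ s' x)| ≤ ε / 2 := by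
    -- w.l.o.g. `s ≤ s'`, by symmetry
    suffices key : ∀ (s s' : ℝ≥0), s ≤ s' → dist s s' < η → ∀ x,
        |(∫ z, f z ∂(κ s' x)) - ∫ z, f z ∂(κ s x)| ≤ ε / 2 by
      intro s s' hd x
      rcases le_total s s' with hle | hle
      · rw [abs_sub_comm]; exact key s s' hle hd x
      · rw [dist_comm] at hd; exact key s' s hle hd x
    intro s s' hle hd x
    obtain ⟨h, rfl⟩ : ∃ h : ℝ≥0, s' = s + h := ⟨s' - s, by rw [add_tsub_cancel_of_le hle]⟩
    have hh : (h : ℝ) < η := by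
      rw [NNReal.dist_eq, NNReal.coe_add] at hd
      have : |(s : ℝ) - (s + h)| = h := by
        rw [show (s : ℝ) - ((s : ℝ) + h) = -(h : ℝ) by ring, abs_neg, abs_of_nonneg h.coe_nonneg]
      linarith [this ▸ hd]
    have hh0 : (0 : ℝ) ≤ h := h.2
    have hb := hC s h x
    have hmono : C * (((h : ℝ) ^ 2) + h) ≤ C * (η ^ 2 + η) := by
      gcongr
    linarith
  -- space direction: Feller at time `t₀`
  have hspace : ∀ᶠ p : ℝ≥0 × GaugeConfig 3 L (Matrix.specialUnitaryGroup (Fin 2) ℂ) in 𝓝 (t₀, x₀),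
      dist (∫ z, f z ∂(κ t₀ p.2)) (∫ z, f z ∂(κ t₀ x₀)) < ε / 2 := by
    have hc : Continuous fun p : ℝ≥0 × GaugeConfig 3 L (Matrix.specialUnitaryGroup (Fin 2) ℂ) => ∫ z, f z ∂(κ t₀ p.2) :=
      (continuous_integral_transitionKernel L β' κ hreal t₀ hf).comp continuous_snd
    exact Metric.tendsto_nhds.1 (hc.tendsto (t₀, x₀)) (ε / 2) (half_pos hε)
  have htime' : ∀ᶠ p : ℝ≥0 × GaugeConfig 3 L (Matrix.specialUnitaryGroup (Fin 2) ℂ) in 𝓝 (t₀, x₀), dist p.1 t₀ < η := by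
    have hc : Continuous fun p : ℝ≥0 × GaugeConfig 3 L (Matrix.specialUnitaryGroup (Fin 2) ℂ) => p.1 := continuous_fst
    exact Metric.tendsto_nhds.1 (hc.tendsto (t₀, x₀)) η hη0
  filter_upwards [hspace, htime'] with p hp1 hp2
  rw [Real.dist_eq] at hp1 ⊢
  calc |(∫ z, f z ∂(κ p.1 p.2)) - ∫ z, f z ∂(κ t₀ x₀)|
      ≤ |(∫ z, f z ∂(κ p.1 p.2)) - ∫ z, f z ∂(κ t₀ p.2)| + |(∫ z, f z ∂(κ t₀ p.2)) - ∫ z, f z ∂(κ t₀ x₀)| :=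
        abs_sub_le _ _ _
    _ < ε / 2 + ε / 2 := add_lt_add_of_le_of_lt (htime p.1 t₀ hp2 p.2) hp1
    _ = ε := add_halves ε

end Summit.QuantumFields.YangMills.Theorems.ColdStartUniversality

end
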